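import Literature.NumberTheory.Transcendental.NesterenkoEliminationProp47ValuesProofs
import Mathlib.RingTheory.RootsOfUnity.Complex
import HarnessLib

/-!
# Values versus coefficients of complex polynomials: trivial bounds and a root-of-unity point

Topic `Literature/NumberTheory/Transcendental` (toolkit for the proof of LNM 1752 Ch. 3 Prop. 4.13,
`NesterenkoEliminationProp413Proofs.lean`). Proofs only, no definitions. For a complex polynomial
`P` in finitely many variables, `|P|` the maximum modulus of its coefficients (Definition 4.1 of
Nesterenko–Philippon (eds.), LNM 1752, Ch. 3 §4, the tree's `maxNorm`) and `‖P‖₁` the sum of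
their moduli (`l1Norm`):

* `norm_eval_le_card_mul_maxNorm` — `|P(w)| ≤ #supp P · |P|` for `|wᵢ| ≤ 1`;
* `maxNorm_aeval_le_card_mul` — substituting polynomials of `‖·‖₁ ≤ 1` for the
  variables (e.g. evaluating some of them at points of modulus `≤ 1` and keeping the others) does
  not increase `‖·‖₁`, hence `|σ(P)| ≤ #supp P · |P|`;
* `exists_eval_ge_norm_coeff`, `exists_eval_ge_maxNorm` — conversely there is a point `z` with
  all `|zᵢ| = 1` (a tuple of `M`-th roots of unity, `M > deg P`) at which `|P(z)| ≥ |P|`: the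
  coefficient `a_e` of `P` is the average of `P(ζ^c) ζ^{−c·e}` over the grid `c ∈ (ℤ/M)^n`
  (discrete Fourier inversion), so some `|P(ζ^c)|` is at least `|a_e|`.

## References

* [NesterenkoPhilippon2001] Yu. V. Nesterenko, P. Philippon (eds.), *Introduction to Algebraic
  Independence Theory*, LNM 1752, Springer 2001, Ch. 3 §4, Definition 4.1 (p. 37).
-/

noncomputable section

open MvPolynomial Finset Complex

namespace Literature.NumberTheory.Transcendental

namespace Nesterenko

variable {ι : Type*} [Fintype ι]

/-! ### Values are bounded by coefficients -/

/-- `|P(w)| ≤ #supp P · |P|` when all `|wᵢ| ≤ 1`. [folklore] -/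
theorem norm_eval_le_card_mul_maxNorm (Q : MvPolynomial ι ℂ) {w : ι → ℂ} (hw : ∀ p, ‖w p‖ ≤ 1) :
    ‖eval w Q‖ ≤ Q.support.card * maxNorm Q := by
  rw [eval_eq']
  calc ‖∑ d ∈ Q.support, Q.coeff d * ∏ i, w i ^ d i‖
      ≤ ∑ d ∈ Q.support, ‖Q.coeff d * ∏ i, w i ^ d i‖ := norm_sum_le _ _
    _ ≤ ∑ _d ∈ Q.support, maxNorm Q := sum_le_sum fun d _ => by
        rw [norm_mul, norm_prod]
        calc ‖coeff d Q‖ * ∏ i, ‖w i ^ d i‖ ≤ maxNorm Q * 1 :=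
              mul_le_mul (norm_coeff_le_maxNorm Q d)
                (prod_le_one (fun i _ => norm_nonneg _) fun i _ => by
                  rw [norm_pow]; exact pow_le_one₀ (norm_nonneg _) (hw i))
                (prod_nonneg fun i _ => norm_nonneg _) (maxNorm_nonneg Q)
          _ = maxNorm Q := mul_one _
    _ = Q.support.card * maxNorm Q := by rw [sum_const, nsmul_eq_mul]

omit [Fintype ι] in
/-- Substituting polynomials of `‖·‖₁ ≤ 1` for the variables (tree: `l1Norm_aeval_le`) gives
`|σ(P)| ≤ #supp P · |P|`. [folklore] -/
theorem maxNorm_aeval_le_card_mul {κ : Type*} (f : ι → MvPolynomial κ ℂ)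
    (hf : ∀ p, l1Norm (f p) ≤ 1) (Q : MvPolynomial ι ℂ) :
    maxNorm (aeval f Q) ≤ Q.support.card * maxNorm Q :=
  (maxNorm_le_l1Norm _).trans ((l1Norm_aeval_le hf Q).trans (l1Norm_le_card_mul_maxNorm Q))

omit [Fintype ι] in
/-- Polynomials of `‖·‖₁ ≤ 1` to substitute: a variable, or a constant of modulus `≤ 1`.
[folklore] -/
theorem l1Norm_ite_le_one {κ : Type*} (s : Set ι) [DecidablePred (· ∈ s)] (z : ι → ℂ)
    (hz : ∀ p, ‖z p‖ ≤ 1) (v : ι → κ) (p : ι) :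
    l1Norm (if p ∈ s then C (z p) else (X (v p) : MvPolynomial κ ℂ)) ≤ 1 := by
  split_ifs
  · rw [l1Norm_C]; exact hz p
  · rw [l1Norm_X]

/-! ### A point of the unit torus where `|P(z)|` is at least a given coefficient -/

/-- Sum of the powers of a non-trivial `M`-th root of unity. [folklore] -/
theorem sum_pow_mul_eq_zero {ξ : ℂ} {M : ℕ} (hM : ξ ^ M = 1) (h1 : ξ ≠ 1) :
    ∑ t : Fin M, ξ ^ (t : ℕ) = 0 := by
  rw [Fin.sum_univ_eq_sum_range (fun t => ξ ^ t)]
  have hgeom := geom_sum_mul ξ M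
  rw [hM, sub_self] at hgeom
  exact (mul_eq_zero.mp hgeom).resolve_right (sub_ne_zero.mpr h1)

/-- **Discrete Fourier inversion bound.** For every exponent `e₀` there is a point `z` with all
`|zᵢ| = 1` (powers of a primitive `M`-th root of unity, `M = deg P + 1`) at which
`|P(z)| ≥ |a_{e₀}(P)|`. [folklore] -/
theorem exists_eval_ge_norm_coeff [DecidableEq ι] (P : MvPolynomial ι ℂ) (e₀ : ι →₀ ℕ) :
    ∃ z : ι → ℂ, (∀ p, ‖z p‖ = 1) ∧ ‖coeff e₀ P‖ ≤ ‖eval z P‖ := by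
  classical
  by_cases he₀ : e₀ ∈ P.support
  swap
  · refine ⟨fun _ => 1, fun _ => by simp, ?_⟩
    rw [notMem_support_iff.mp he₀, norm_zero]
    exact norm_nonneg _
  set M := P.totalDegree + 1 with hMdef
  have hM0 : M ≠ 0 := Nat.succ_ne_zero _
  -- all exponents occurring in `P` are `< M`
  have hlt : ∀ e ∈ P.support, ∀ p, e p < M := by
    intro e he p
    have h1 : e p ≤ e.sum fun _ k => k := by
      by_cases hp : p ∈ e.support
      · exact Finset.single_le_sum (fun _ _ => Nat.zero_le _) hp
      · rw [Finsupp.notMem_support_iff.mp hp]; exact Nat.zero_le _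
    have h2 := le_totalDegree he
    omega
  set ζ : ℂ := exp (2 * Real.pi * I / M) with hζdef
  have hζ : IsPrimitiveRoot ζ M := Complex.isPrimitiveRoot_exp M hM0
  have hζnorm : ‖ζ‖ = 1 := by
    rw [hζdef, norm_exp]
    simp
  have hζpow : ∀ n : ℕ, ‖ζ ^ n‖ = 1 := fun n => by rw [norm_pow, hζnorm, one_pow]
  -- the grid `z_c = (ζ^{c_p})_p` and the weights `ω_c = ∏_p ζ^{c_p (M - e₀ p)}`
  set z : (ι → Fin M) → ι → ℂ := fun c p => ζ ^ (c p : ℕ) with hz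
  set ω : (ι → Fin M) → ℂ := fun c => ∏ p, ζ ^ ((c p : ℕ) * (M - e₀ p)) with hω
  have hω1 : ∀ c, ‖ω c‖ = 1 := fun c => by
    rw [hω, norm_prod]
    exact prod_eq_one fun p _ => hζpow _
  -- the key identity `∑_c P(z_c) ω_c = a_{e₀} M^{#ι}`
  have step1 : ∀ c, eval (z c) P * ω c =
      ∑ e ∈ P.support, coeff e P * ∏ p, ζ ^ ((c p : ℕ) * (e p + (M - e₀ p))) := by
    intro c
    rw [eval_eq', sum_mul]
    refine sum_congr rfl fun e _ => ?_
    rw [mul_assoc, hω, ← prod_mul_distrib]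
    congr 1
    refine prod_congr rfl fun p _ => ?_
    rw [hz, ← pow_mul, ← pow_add, mul_add]
  have step2 : ∀ e ∈ P.support,
      ∑ c : ι → Fin M, ∏ p, ζ ^ ((c p : ℕ) * (e p + (M - e₀ p))) =
        if e = e₀ then (M : ℂ) ^ Fintype.card ι else 0 := by
    intro e he
    have hswap : ∑ c : ι → Fin M, ∏ p, ζ ^ ((c p : ℕ) * (e p + (M - e₀ p))) =
        ∏ p, ∑ t : Fin M, ζ ^ ((t : ℕ) * (e p + (M - e₀ p))) := by
      rw [← Finset.sum_prod_piFinset Finset.univ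
        (fun p (t : Fin M) => ζ ^ ((t : ℕ) * (e p + (M - e₀ p)))), Fintype.piFinset_univ]
    rw [hswap]
    by_cases hee : e = e₀
    · subst hee
      rw [if_pos rfl]
      have hin : ∀ p, ∑ t : Fin M, ζ ^ ((t : ℕ) * (e p + (M - e p))) = M := by
        intro p
        have hp : e p + (M - e p) = M := by have := hlt e he p; omega
        rw [hp]
        have h1 : ∀ t : Fin M, ζ ^ ((t : ℕ) * M) = 1 := fun t => by
          rw [pow_mul', hζ.pow_eq_one, one_pow]
        simp [h1]
      simp [hin]
    · rw [if_neg hee]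
      obtain ⟨p, hp⟩ : ∃ p, e p ≠ e₀ p := by
        by_contra h
        push Not at h
        exact hee (Finsupp.ext h)
      apply prod_eq_zero (mem_univ p)
      set a := e p + (M - e₀ p) with ha
      have hep := hlt e he p
      have he₀p := hlt e₀ he₀ p
      have hnd : ¬ M ∣ a := by
        rintro ⟨k, hk⟩
        rcases k with _ | _ | k
        · omega
        · omega
        · have : M * 2 ≤ M * (k + 1 + 1) := Nat.mul_le_mul_left M (by omega)
          omega
      have hζa : ζ ^ a ≠ 1 := fun h => hnd ((hζ.pow_eq_one_iff_dvd a).mp h)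
      have haM : (ζ ^ a) ^ M = 1 := by rw [← pow_mul, mul_comm, pow_mul, hζ.pow_eq_one, one_pow]
      have := sum_pow_mul_eq_zero haM hζa
      simp_rw [← pow_mul] at this
      convert this using 2 with t
      ring_nf
  have key : ∑ c : ι → Fin M, eval (z c) P * ω c = coeff e₀ P * (M : ℂ) ^ Fintype.card ι := by
    simp_rw [step1]
    rw [sum_comm]
    have h1 : ∀ e ∈ P.support, ∑ c : ι → Fin M, coeff e P * ∏ p, ζ ^ ((c p : ℕ) * (e p + (M - e₀ p)))
        = if e = e₀ then coeff e₀ P * (M : ℂ) ^ Fintype.card ι else 0 := by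
      intro e he
      rw [← mul_sum, step2 e he]
      split_ifs with h
      · subst h; rfl
      · rw [mul_zero]
    rw [sum_congr rfl h1, sum_ite_eq' P.support e₀, if_pos he₀]
  -- hence `M^{#ι} |a_{e₀}| ≤ ∑_c |P(z_c)|`, and some term is at least the average
  have hsum : ∑ _c : ι → Fin M, ‖coeff e₀ P‖ ≤ ∑ c : ι → Fin M, ‖eval (z c) P‖ := by
    have hcard : (Finset.univ : Finset (ι → Fin M)).card = M ^ Fintype.card ι := by
      rw [Finset.card_univ, Fintype.card_fun, Fintype.card_fin]
    calc ∑ _c : ι → Fin M, ‖coeff e₀ P‖ = (M : ℝ) ^ Fintype.card ι * ‖coeff e₀ P‖ := by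
          rw [sum_const, hcard, nsmul_eq_mul]; push_cast; ring
      _ = ‖coeff e₀ P * (M : ℂ) ^ Fintype.card ι‖ := by
          rw [norm_mul, norm_pow, Complex.norm_natCast, mul_comm]
      _ = ‖∑ c : ι → Fin M, eval (z c) P * ω c‖ := by rw [key]
      _ ≤ ∑ c : ι → Fin M, ‖eval (z c) P * ω c‖ := norm_sum_le _ _
      _ = ∑ c : ι → Fin M, ‖eval (z c) P‖ :=
          sum_congr rfl fun c _ => by rw [norm_mul, hω1 c, mul_one]
  have hne : (Finset.univ : Finset (ι → Fin M)).Nonempty :=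
    ⟨fun _ => ⟨0, Nat.pos_of_ne_zero hM0⟩, mem_univ _⟩
  obtain ⟨c, -, hc⟩ := Finset.exists_le_of_sum_le hne hsum
  exact ⟨z c, fun p => hζpow _, hc⟩

/-- **A point of the unit torus where `|P(z)| ≥ |P|`** (the maximum modulus of the
coefficients). [folklore] -/
theorem exists_eval_ge_maxNorm [DecidableEq ι] (P : MvPolynomial ι ℂ) :
    ∃ z : ι → ℂ, (∀ p, ‖z p‖ = 1) ∧ maxNorm P ≤ ‖eval z P‖ := by
  by_cases hP : P = 0
  · refine ⟨fun _ => 1, fun _ => by simp, ?_⟩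
    rw [hP, maxNorm_zero]
    exact norm_nonneg _
  obtain ⟨e, -, he⟩ := exists_norm_coeff_eq_maxNorm hP
  obtain ⟨z, hz, hle⟩ := exists_eval_ge_norm_coeff P e
  exact ⟨z, hz, by rw [← he]; exact hle⟩

end Nesterenko

end Literature.NumberTheory.Transcendental

end
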